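import Literature.Claims.NS.LiuYong2026
import Literature.Analysis.FluidPDE.LerayHopfSpectralMeasurability
import Literature.Analysis.FunctionSpaces.TorusSpectralWeakDerivative
import Literature.Analysis.FunctionSpaces.TorusInverseLaplacian
import HarnessLib

/-!
# Solo salvage for claim C138 `LiuYong2026` (cell `ns-claims`, D-0090): at the Clay grain `f ≡ 0` every
# global Leray–Hopf solution on `𝕋³` HAS a Cesàro energy spectrum — identically zero

Claim skeleton: `Literature.Claims.NS.LiuYong2026` (typist-7 g5, p508975). Step 1 of the printed chain
(§4.3 p.16 L21–p.17 L1) asserts that every global weak solution of the FORCED problem has a Cesàro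
(long-time averaged) energy spectrum `Φ(k) = lim_{T→∞} T⁻¹∫₀ᵀ ½|û(k,t)|² dt` «by ergodicity»
(`Step1_cesaro`, refuter's lane). This file records the TRUE special case the rest of the chain silently
lives on: for the UNFORCED equations (`f ≡ 0`, the Clay (B) grain) the limit exists for every global
Leray–Hopf solution and every mode `k ≠ 0`, and it is ZERO — because the energy inequality makes the
dissipation `∫₀^∞ ‖∇u‖₂²` finite and one mode's energy is dominated by the dissipation integrand:
`8π² · ½|û(k,t)|² ≤ 4π²|k|²|û(k,t)|² ≤ ‖∇u(t)‖₂²`, so `∫₀ᵀ 𝓔(k,t)dt ≤ E(u₀)/(8π²ν)` uniformly in `T`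
and `T⁻¹∫₀ᵀ 𝓔(k,t)dt → 0`.

* `modeEnergy_le_eGradNormSq` — `ofReal (8π² 𝓔(k,·)) ≤ ‖∇·‖₂²` (spectral, `k ≠ 0`);
* `integral_modeEnergy_le` — `0 ≤ ∫₀ᵀ 𝓔(k,t)dt ≤ E(u₀)/(8π²ν)` along an unforced global Leray–Hopf
  solution (`ν > 0`, `T > 0`);
* `hasCesaroSpectrum_zero_of_unforced` — `HasCesaroSpectrum u (fun _ => 0)`.

Consequences for the reading of the chain (recorded in prose, not asserted about the text): at `f ≡ 0`
the K41 law of Step 3 (`IsK41 Φ`, a POSITIVE constant) fails for every datum, while the K41 UPPER bound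
and infrared boundedness consumed by Step 4 (`IsK41Upper`, `InfraredBounded`) hold trivially for `Φ ≡ 0` —
so the Step-4(upper)/Step-5 part of the chain, read at the Clay grain, quantifies over ALL unforced
Leray–Hopf solutions (cf. `Literature.Barriers.NavierStokesRegularity.CesaroSpectrumNoSupControl`: a
time-averaged spectrum cannot control `sup_t ‖u(t)‖_{H^s}`). TRUE mathematics only; salvage seat
ns-claims-salvage-p5 g3. Solo lane (no item).

WHAT THIS IS NOT: not a claim about NS regularity or blow-up; not a claim about any author beyond the
typed locator.
-/

-- lint debt (one line): the Theorems namespace repeats the summit name by the D-0017 layout.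
set_option linter.dupNamespace false

noncomputable section

open Set Filter Topology MeasureTheory UnitAddTorus
open scoped ENNReal

namespace Summit.NavierStokesRegularity.NavierStokesRegularity.Theorems.LiuYong2026Salvage

open Literature.Claims.NS.LiuYong2026
open Literature.Analysis.FunctionSpaces Literature.Analysis.FunctionSpaces.Torus
open Literature.Analysis.FluidPDE

/-- `𝓔(k,·) ≥ 0`. [cite: LiuYong2026, §4.3 p.16 L19–L20] -/
theorem modeEnergy_nonneg (v : T3 → E3) (k : Z3) : 0 ≤ modeEnergy v k := by
  unfold modeEnergy; positivity

/-- **One mode is dominated by the dissipation integrand**: for `k ≠ 0`,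
`ofReal (8π² · 𝓔(k)) = 4π²‖v̂(k)‖² ≤ 4π²|k|²‖v̂(k)‖² ≤ ‖∇v‖₂²` (spectral `Torus.eGradNormSq`).
[cite: LiuYong2026, 引理H.1 proof p.57 L11–L12 (Parseval)] -/
theorem modeEnergy_le_eGradNormSq (v : T3 → E3) {k : Z3} (hk : k ≠ 0) :
    ENNReal.ofReal (8 * Real.pi ^ 2 * modeEnergy v k) ≤ eGradNormSq v := by
  rw [eGradNormSq_eq_tsum]
  have h1 : 1 ≤ freqNormSq k := one_le_freqNormSq_of_ne_zero hk
  have hterm : ENNReal.ofReal (freqNormSq k) *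
      ‖mFourierCoeff (EuclideanSpace.complexify ∘ v) k‖ₑ ^ 2 ≤
      ∑' m : Z3, ENNReal.ofReal (freqNormSq m) *
        ‖mFourierCoeff (EuclideanSpace.complexify ∘ v) m‖ₑ ^ 2 :=
    ENNReal.le_tsum (f := fun m : Z3 => ENNReal.ofReal (freqNormSq m) *
      ‖mFourierCoeff (EuclideanSpace.complexify ∘ v) m‖ₑ ^ 2) k
  have hcoef : ENNReal.ofReal (8 * Real.pi ^ 2 * modeEnergy v k) =
      ENNReal.ofReal (4 * Real.pi ^ 2) * ‖mFourierCoeff (EuclideanSpace.complexify ∘ v) k‖ₑ ^ 2 := by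
    unfold modeEnergy coeff
    rw [show 8 * Real.pi ^ 2 * (1 / 2 * ‖mFourierCoeff (⇑EuclideanSpace.complexify ∘ v) k‖ ^ 2) =
        (4 * Real.pi ^ 2) * ‖mFourierCoeff (⇑EuclideanSpace.complexify ∘ v) k‖ ^ 2 by ring,
      ENNReal.ofReal_mul (by positivity), ← ofReal_norm, ← ENNReal.ofReal_pow (norm_nonneg _)]
  rw [hcoef]
  have hk1 : ‖mFourierCoeff (EuclideanSpace.complexify ∘ v) k‖ₑ ^ 2 ≤
      ENNReal.ofReal (freqNormSq k) * ‖mFourierCoeff (EuclideanSpace.complexify ∘ v) k‖ₑ ^ 2 := by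
    calc ‖mFourierCoeff (EuclideanSpace.complexify ∘ v) k‖ₑ ^ 2
        = 1 * ‖mFourierCoeff (EuclideanSpace.complexify ∘ v) k‖ₑ ^ 2 := (one_mul _).symm
      _ ≤ ENNReal.ofReal (freqNormSq k) * ‖mFourierCoeff (EuclideanSpace.complexify ∘ v) k‖ₑ ^ 2 := by
          refine mul_le_mul_left ?_ _
          rw [← ENNReal.ofReal_one]
          exact ENNReal.ofReal_le_ofReal h1
  exact mul_le_mul_right (hk1.trans hterm) _

/-- **Uniform bound on the time-integrated modal energy** along an UNFORCED global Leray–Hopf solution: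
`0 ≤ ∫₀ᵀ 𝓔(k,t) dt ≤ E(u₀)/(8π²ν)` for every `T > 0` and `k ≠ 0` (energy inequality from `0` + the
finiteness of the spectral dissipation + `modeEnergy_le_eGradNormSq`). [cite: LiuYong2026, 定理2.2 p.5–6 (energy inequality)] -/
theorem integral_modeEnergy_le {ν : ℝ} (hν : 0 < ν) {u₀ : T3 → E3} {u : ℝ → T3 → E3}
    (hu : Torus.IsGlobalLerayHopf ν 0 u₀ u) {k : Z3} (hk : k ≠ 0) {T : ℝ} (hT : 0 < T) :
    0 ≤ ∫ t in (0 : ℝ)..T, modeEnergy (u t) k ∧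
      ∫ t in (0 : ℝ)..T, modeEnergy (u t) k ≤ kineticEnergy u₀ / (8 * Real.pi ^ 2 * ν) := by
  refine ⟨intervalIntegral.integral_nonneg hT.le fun t _ => modeEnergy_nonneg _ _, ?_⟩
  have h := hu (T + 1) (by linarith)
  -- (1) the energy inequality from `0` at time `T`, force `0`
  have hE := h.energy_ineq_zero T ⟨hT.le, by linarith⟩
  have hforce : ∫ τ in (0 : ℝ)..T, ∫ x, inner ℝ ((0 : ℝ → T3 → E3) τ x) (u τ x) = 0 := by simp
  rw [hforce, add_zero] at hE
  have hkin : 0 ≤ kineticEnergy (u T) := by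
    unfold kineticEnergy; positivity
  have hdiss : (∫⁻ τ in Ioo 0 T, eGradNormSq (u τ)).toReal ≤ kineticEnergy u₀ / ν := by
    rw [le_div_iff₀ hν]; nlinarith
  -- (2) finiteness of the dissipation on `(0, T)`
  have hfin : ∫⁻ τ in Ioo 0 T, eGradNormSq (u τ) < ∞ :=
    lt_of_le_of_lt (lintegral_mono_set (Ioo_subset_Ioo_right (by linarith)))
      h.lintegral_eGradNormSq_lt_top
  -- (3) measurability of the modal energy in time
  have hmeas : AEMeasurable (fun t => 8 * Real.pi ^ 2 * modeEnergy (u t) k)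
      (volume.restrict (Ioc 0 T)) := by
    have h1 := (h.aemeasurable_enorm_sq_mFourierCoeff k).ennreal_toReal
    have h2 : AEMeasurable (fun t => 8 * Real.pi ^ 2 * modeEnergy (u t) k)
        (volume.restrict (Ioo 0 (T + 1))) := by
      refine ((h1.const_mul (1 / 2 : ℝ)).const_mul (8 * Real.pi ^ 2)).congr ?_
      filter_upwards with t
      unfold modeEnergy coeff
      rw [← ofReal_norm, ← ENNReal.ofReal_pow (norm_nonneg _),
        ENNReal.toReal_ofReal (by positivity)]
    exact h2.mono_measure (Measure.restrict_mono (Ioc_subset_Ioo_right (by linarith)) le_rfl)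
  -- (4) the real integral as a lower integral, bounded by the dissipation
  have hnn : 0 ≤ᵐ[volume.restrict (Ioc 0 T)] fun t => 8 * Real.pi ^ 2 * modeEnergy (u t) k :=
    Eventually.of_forall fun t => by have := modeEnergy_nonneg (u t) k; positivity
  have hI : ∫ t in (0 : ℝ)..T, 8 * Real.pi ^ 2 * modeEnergy (u t) k ≤ kineticEnergy u₀ / ν := by
    rw [intervalIntegral.integral_of_le hT.le,
      integral_eq_lintegral_of_nonneg_ae hnn hmeas.aestronglyMeasurable]
    have hle : ∫⁻ t in Ioc 0 T, ENNReal.ofReal (8 * Real.pi ^ 2 * modeEnergy (u t) k) ≤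
        ∫⁻ τ in Ioo 0 T, eGradNormSq (u τ) := by
      rw [← setLIntegral_congr Ioo_ae_eq_Ioc]
      exact lintegral_mono fun t => modeEnergy_le_eGradNormSq (u t) hk
    exact (ENNReal.toReal_mono hfin.ne hle).trans hdiss
  rw [intervalIntegral.integral_const_mul] at hI
  rw [le_div_iff₀ (by positivity)]
  calc (∫ t in (0 : ℝ)..T, modeEnergy (u t) k) * (8 * Real.pi ^ 2 * ν)
      = (8 * Real.pi ^ 2 * ∫ t in (0 : ℝ)..T, modeEnergy (u t) k) * ν := by ring
    _ ≤ kineticEnergy u₀ / ν * ν := by gcongr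
    _ = kineticEnergy u₀ := div_mul_cancel₀ _ hν.ne'

/-- **At the Clay grain `f ≡ 0`, every global Leray–Hopf solution on `𝕋³` has the Cesàro spectrum
`Φ ≡ 0`**: for `ν > 0` and every `k ≠ 0`, `T⁻¹ ∫₀ᵀ ½|û(k,t)|² dt → 0` as `T → ∞` (the time integral is
bounded by `E(u₀)/(8π²ν)`, `integral_modeEnergy_le`). So Step 1's limit exists in the unforced case —
and kills the positive-constant K41 law there. [cite: LiuYong2026, §4.3 p.16 L21–p.17 L1] -/
theorem hasCesaroSpectrum_zero_of_unforced {ν : ℝ} (hν : 0 < ν) {u₀ : T3 → E3} {u : ℝ → T3 → E3}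
    (hu : Torus.IsGlobalLerayHopf ν 0 u₀ u) : HasCesaroSpectrum u (fun _ => 0) := by
  intro k hk
  set M : ℝ := kineticEnergy u₀ / (8 * Real.pi ^ 2 * ν) with hM
  have hup : Tendsto (fun T : ℝ => M * T⁻¹) atTop (𝓝 0) := by
    simpa using tendsto_const_nhds.mul tendsto_inv_atTop_zero (f := fun _ : ℝ => M)
  refine squeeze_zero_norm' ?_ hup
  filter_upwards [eventually_gt_atTop (0 : ℝ)] with T hT
  obtain ⟨h0, h1⟩ := integral_modeEnergy_le hν hu hk hT
  rw [Real.norm_eq_abs, abs_of_nonneg (mul_nonneg (inv_nonneg.2 hT.le) h0), mul_comm]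
  exact mul_le_mul_of_nonneg_right h1 (inv_nonneg.2 hT.le)

end Summit.NavierStokesRegularity.NavierStokesRegularity.Theorems.LiuYong2026Salvage
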